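import Summits.ValiantsHypothesis.ValiantsHypothesis.Theorems.LacunarySymmetroidMatrixDescartesCensusChamberSignClass

/-!
# `MatrixDescartes` census — chamber-uniform sign-class kill of ONE ORIENTATION (a `V = 20` cell of a chamber)

HONEST FRAMING.  Object-search cell `pub-symmetroid`, door-A target `DoorA26 := PosRootLawAt 2 6 19`
(stmt-ValiantsHypothesis-19979; OPEN, typed, never asserted), crux `Theses.LacunarySymmetroid.MatrixDescartes`
(stmt-ValiantsHypothesis-18050).  The companion file `…CensusChamberSignClass.lean` kills a whole chamber when BOTH
orientations of its `V = 20` sign pattern carry an odd definite triangle (126 of the 2 608 chambers).  In theory g6's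
census (CHAMBERS-2-6.md §3) a further 1 926 chambers have exactly ONE orientation dead at sign level; there the door-A row
needs a magnitude argument only for the other orientation.  This file types that half, chamber-uniformly:

* `no_twenty_on_chamber_cell` — data: an order `σ` of the 21 pairs (covering all pairs, `σ 0 = (i₀,i₀)` the lowest sum),
  an orientation `η ∈ ℕ` (read mod 2: the lowest coefficient `det S_{i₀}` has sign `(−1)^η`), and ONE odd definite triangle
  for that orientation (letters `i j k`, diagonal positions `a b c` with `a + η`, `b + η`, `c + η` even, mixed positions
  `e f g` with `e + f + g + η` odd — decidable); conclusion: for EVERY exponent vector `d` of the chamber, no real symmetric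
  `2 × 2` pencil on `d` with `(−1)^η det S_{i₀} > 0` has `20` distinct positive det-roots;
* `posRootLawOn_of_chamber_cell` — the composable form: such a certificate for orientation `η` plus ANY argument excluding
  twenties of the opposite orientation gives the door-A row `PosRootLawOn 2 6 19 d` on the whole chamber (the vanishing
  case `det S_{i₀} = 0` costs a monomial and is Descartes);
* two instances (the mirror pair 1406 / 2183 of theory g6's table, words `DIDIDD` / `DDIDID`: the `+` cells die on
  the whole chamber by the triangles `{0,2,4}` / `{0,3,5}`; their smallest members lie inside BOX20).

SIGN layer only; the opposite cells of these chambers are «undecided»/«M-realised» at sign level in the atlas and need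
magnitude rows (or the L-pair/L-tri rules), which are NOT here.  Nothing in this file bears on `V = 19`, on `DoorA26` as a whole
(OPEN), on the crux, or on `VP ≠ VNP`.

[folklore] Elementary bookkeeping over the cell's sign-class certificate (C22); no citation exists or is needed.
-/

-- `Summit.ValiantsHypothesis.ValiantsHypothesis.…` repeats a component by the D-0017 layout
-- (single-conjunct summit), which the `dupNamespace` linter flags; the name is mandated.
set_option linter.dupNamespace false

namespace Summit.ValiantsHypothesis.ValiantsHypothesis.Theorems.LacunarySymmetroidMatrixDescartes.Census

open Polynomial Finset
open scoped BigOperators Polynomial Matrix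

/-- **ONE-ORIENTATION CHAMBER-UNIFORM SIGN-CLASS KILL.**  Let `σ` list the 21 pairs in the order of their sums
(`σ 0 = (i₀, i₀)` is the lowest), let `η` encode the orientation «`(−1)^η · det S_{i₀} > 0`», and let `i j k` be an odd
definite triangle for that orientation: diagonal positions `a b c` with `a + η`, `b + η`, `c + η` even (the three letters
are definite) and mixed positions `e f g` with `e + f + g + η` odd (the three polarised determinants would have signs of
odd product, against `sign B(Sᵢ,Sⱼ) = σᵢσⱼ`).  Then on EVERY exponent vector `d` of the chamber no real symmetric `2 × 2`
pencil of that orientation has `20 = D(2,6)` distinct positive det-roots. [folklore] -/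
theorem no_twenty_on_chamber_cell (σ : Fin 21 → Fin 6 × Fin 6) (η : ℕ) (i₀ i j k : Fin 6) (a b c e f g : Fin 21)
    (hcert : (∀ p : Fin 6 × Fin 6, ∃ t : Fin 21, σ t = p ∨ σ t = p.swap) ∧ σ 0 = (i₀, i₀) ∧
      (i ≠ j ∧ j ≠ k ∧ i ≠ k) ∧
      (σ a = (i, i) ∧ σ b = (j, j) ∧ σ c = (k, k) ∧ σ e = (i, j) ∧ σ f = (j, k) ∧ σ g = (i, k)) ∧
      (Even ((a : ℕ) + η) ∧ Even ((b : ℕ) + η) ∧ Even ((c : ℕ) + η) ∧ Odd ((e : ℕ) + f + g + η)))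
    (d : Fin 6 → ℕ) (hd : StrictMono ((fun p : Fin 6 × Fin 6 => d p.1 + d p.2) ∘ σ))
    (S : Fin 6 → Matrix (Fin 2) (Fin 2) ℝ) (hS : ∀ l, (S l).IsSymm)
    (hZ : 20 ≤ ((∑ l, ((X : ℝ[X]) ^ d l) • (S l).map C).det.roots.toFinset.filter (fun t => 0 < t)).card)
    (hs : 0 < (-1 : ℝ) ^ η * (S i₀ 0 0 * S i₀ 1 1 - S i₀ 0 1 ^ 2)) : False := by
  obtain ⟨hcov, h0, ⟨hij, hjk, hik⟩, ⟨ha, hb, hc, he, hf, hg⟩, ⟨pa, pb, pc, po⟩⟩ := hcert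
  set P := (∑ l, ((X : ℝ[X]) ^ d l) • (S l).map C).det with hP_def
  set W := (Finset.univ : Finset (Fin 6 × Fin 6)).image (fun p => d p.1 + d p.2) with hW_def
  have hN : W.card = 21 := card_pairSums_of_chamber σ hcov d hd
  have memW : ∀ u v : Fin 6, d u + d v ∈ W := fun u v =>
    Finset.mem_image.mpr ⟨(u, v), Finset.mem_univ _, rfl⟩
  have hP : P ≠ 0 := by
    intro hP0
    have : (P.roots.toFinset.filter (fun t => 0 < t)).card = 0 := by rw [hP0]; simp
    omega
  have hsupp : P.support = W := by
    have hsub : P.support ⊆ W := by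
      rw [hP_def, hW_def, ← sumset_two_eq_pairSums d]; exact support_det_pencil_subset_sumset d S
    refine Finset.eq_of_subset_of_card_le hsub ?_
    have h := Literature.Computability.AlgebraicComplexity.card_roots_toFinset_filter_pos_lt_card_support hP
    omega
  have hZ' : P.support.card ≤ (P.roots.toFinset.filter (fun t => 0 < t)).card + 1 := by
    rw [hsupp]; omega
  -- F1 in rank form
  have F1 : ∀ x y : ℕ, x ∈ W → y ∈ W →
      0 < (-1 : ℝ) ^ ((W.filter (· < x)).card + (W.filter (· < y)).card) * (P.coeff x * P.coeff y) := by
    intro x y hx hy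
    have := pow_rank_mul_coeff_mul_coeff_pos_of_sharp P hZ' (by rw [hsupp]; exact hx) (by rw [hsupp]; exact hy)
    rwa [hsupp] at this
  -- chamber bookkeeping: listed sums, uniqueness, ranks
  have hsum : ∀ {t : Fin 21} {u v : Fin 6}, σ t = (u, v) → d u + d v = d (σ t).1 + d (σ t).2 := by
    intro t u v ht; rw [ht]
  have udiag : ∀ {t : Fin 21} {u : Fin 6}, σ t = (u, u) →
      ∀ p : Fin 6 × Fin 6, d p.1 + d p.2 = d u + d u → p = (u, u) := by
    intro t u ht p hp
    rw [hsum ht] at hp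
    rcases pair_eq_of_chamber σ hcov d hd t p hp with h | h
    · rw [h, ht]
    · rw [h, ht]; rfl
  have upair : ∀ {t : Fin 21} {u v : Fin 6}, σ t = (u, v) →
      ∀ p : Fin 6 × Fin 6, d p.1 + d p.2 = d u + d v → p = (u, v) ∨ p = (v, u) := by
    intro t u v ht p hp
    rw [hsum ht] at hp
    rcases pair_eq_of_chamber σ hcov d hd t p hp with h | h
    · left; rw [h, ht]
    · right; rw [h, ht]; rfl
  have rk : ∀ {t : Fin 21} {u v : Fin 6}, σ t = (u, v) → (W.filter (· < d u + d v)).card = t := by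
    intro t u v ht
    rw [hsum ht]
    exact card_filter_lt_of_chamber σ hcov d hd t
  -- the dictionary (F0) in entry coordinates
  have hsym : ∀ l, S l 1 0 = S l 0 1 := fun l => by
    have h := congrFun (congrFun (hS l) 1) 0
    simp only [Matrix.transpose_apply] at h
    exact h.symm
  have hdiag : ∀ {t : Fin 21} {u : Fin 6}, σ t = (u, u) → P.coeff (d u + d u) = S u 0 0 * S u 1 1 - S u 0 1 ^ 2 := by
    intro t u ht; rw [hP_def, coeff_det_pencil_two_diag d S u (udiag ht), hsym, sq]
  have hpair : ∀ {t : Fin 21} {u v : Fin 6}, σ t = (u, v) → u ≠ v →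
      P.coeff (d u + d v) = S u 0 0 * S v 1 1 + S u 1 1 * S v 0 0 - 2 * (S u 0 1 * S v 0 1) := by
    intro t u v ht huv; rw [hP_def, coeff_det_pencil_two_pair d S huv (upair ht), hsym, hsym]; ring
  -- every twisted coefficient has the sign of the orientation
  have tw : ∀ x : ℕ, x ∈ W → 0 < (-1 : ℝ) ^ ((W.filter (· < x)).card + η) * P.coeff x := by
    intro x hx
    have h1 := F1 (d i₀ + d i₀) x (memW i₀ i₀) hx
    rw [rk h0, hdiag h0] at h1
    simp only [Fin.val_zero, zero_add] at h1
    -- h1 : 0 < (-1)^rank x * (q₀ * c x); hs : 0 < (-1)^η * q₀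
    have h2 : 0 < ((-1 : ℝ) ^ (W.filter (· < x)).card * ((S i₀ 0 0 * S i₀ 1 1 - S i₀ 0 1 ^ 2) * P.coeff x)) *
        ((-1 : ℝ) ^ η * (S i₀ 0 0 * S i₀ 1 1 - S i₀ 0 1 ^ 2)) := mul_pos h1 hs
    have h3 : ((-1 : ℝ) ^ (W.filter (· < x)).card * ((S i₀ 0 0 * S i₀ 1 1 - S i₀ 0 1 ^ 2) * P.coeff x)) *
        ((-1 : ℝ) ^ η * (S i₀ 0 0 * S i₀ 1 1 - S i₀ 0 1 ^ 2))
        = ((-1 : ℝ) ^ ((W.filter (· < x)).card + η) * P.coeff x) * (S i₀ 0 0 * S i₀ 1 1 - S i₀ 0 1 ^ 2) ^ 2 := by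
      rw [pow_add]; ring
    rw [h3] at h2
    exact pos_of_mul_pos_left h2 (sq_nonneg _)
  -- the three definite letters
  have hdet : ∀ {t : Fin 21} {u : Fin 6}, σ t = (u, u) → Even ((t : ℕ) + η) → 0 < S u 0 0 * S u 1 1 - S u 0 1 ^ 2 := by
    intro t u ht hev
    have := tw _ (memW u u)
    rw [rk ht, hev.neg_one_pow, hdiag ht] at this
    linarith
  -- the three mixed letters, twisted
  have hmix : ∀ {t : Fin 21} {u v : Fin 6}, σ t = (u, v) → u ≠ v →
      0 < (-1 : ℝ) ^ ((t : ℕ) + η) * (S u 0 0 * S v 1 1 + S u 1 1 * S v 0 0 - 2 * (S u 0 1 * S v 0 1)) := by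
    intro t u v ht huv
    have := tw _ (memW u v)
    rwa [rk ht, hpair ht huv] at this
  have hΔi := hdet ha pa
  have hΔj := hdet hb pb
  have hΔk := hdet hc pc
  have hβij := hmix he hij
  have hβjk := hmix hf hjk
  have hβik := hmix hg hik
  have hodd : Odd (((e : ℕ) + η) + ((f : ℕ) + η) + ((g : ℕ) + η)) := by
    obtain ⟨m, hm⟩ := po; exact ⟨m + η, by omega⟩
  have hprod := prod_neg_of_pos_twists_odd hβij hβjk hβik hodd
  have htri := polarDet_triangle_pos (S i 0 0) (S i 0 1) (S i 1 1) (S j 0 0) (S j 0 1) (S j 1 1)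
    (S k 0 0) (S k 0 1) (S k 1 1) hΔi hΔj hΔk
  linarith

/-- **Composable form.**  A sign-class certificate for the orientation `η` of the chamber of `σ`, together with ANY
argument excluding twenties of the opposite orientation on `d` (hypothesis `hother`), gives the door-A row
`ζ(2,6; d) ≤ 19` for every `d` in the chamber; the degenerate case `det S_{i₀} = 0` loses a monomial and is Descartes
(`#Z₊ < #supp ≤ 20`). [folklore] -/
theorem posRootLawOn_of_chamber_cell (σ : Fin 21 → Fin 6 × Fin 6) (η : ℕ) (i₀ i j k : Fin 6) (a b c e f g : Fin 21)
    (hcert : (∀ p : Fin 6 × Fin 6, ∃ t : Fin 21, σ t = p ∨ σ t = p.swap) ∧ σ 0 = (i₀, i₀) ∧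
      (i ≠ j ∧ j ≠ k ∧ i ≠ k) ∧
      (σ a = (i, i) ∧ σ b = (j, j) ∧ σ c = (k, k) ∧ σ e = (i, j) ∧ σ f = (j, k) ∧ σ g = (i, k)) ∧
      (Even ((a : ℕ) + η) ∧ Even ((b : ℕ) + η) ∧ Even ((c : ℕ) + η) ∧ Odd ((e : ℕ) + f + g + η)))
    (d : Fin 6 → ℕ) (hd : StrictMono ((fun p : Fin 6 × Fin 6 => d p.1 + d p.2) ∘ σ))
    (hother : ∀ (S : Fin 6 → Matrix (Fin 2) (Fin 2) ℝ), (∀ l, (S l).IsSymm) →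
      20 ≤ ((∑ l, ((X : ℝ[X]) ^ d l) • (S l).map C).det.roots.toFinset.filter (fun t => 0 < t)).card →
      0 < (-1 : ℝ) ^ (η + 1) * (S i₀ 0 0 * S i₀ 1 1 - S i₀ 0 1 ^ 2) → False) :
    PosRootLawOn 2 6 19 d := by
  intro S hS
  by_contra hcon
  have hZ : 20 ≤ ((∑ l, ((X : ℝ[X]) ^ d l) • (S l).map C).det.roots.toFinset.filter (fun t => 0 < t)).card := by
    omega
  rcases lt_trichotomy 0 ((-1 : ℝ) ^ η * (S i₀ 0 0 * S i₀ 1 1 - S i₀ 0 1 ^ 2)) with hpos | hzero | hneg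
  · exact no_twenty_on_chamber_cell σ η i₀ i j k a b c e f g hcert d hd S hS hZ hpos
  · -- `det S_{i₀} = 0`: the lowest monomial is missing, Descartes gives `≤ 19`
    obtain ⟨hcov, h0, -, -, -⟩ := hcert
    set P := (∑ l, ((X : ℝ[X]) ^ d l) • (S l).map C).det with hP_def
    set W := (Finset.univ : Finset (Fin 6 × Fin 6)).image (fun p => d p.1 + d p.2) with hW_def
    have hN : W.card = 21 := card_pairSums_of_chamber σ hcov d hd
    have hq : S i₀ 0 0 * S i₀ 1 1 - S i₀ 0 1 ^ 2 = 0 := by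
      have hu : ((-1 : ℝ) ^ η) ≠ 0 := pow_ne_zero _ (by norm_num)
      rcases mul_eq_zero.mp hzero.symm with h | h
      · exact absurd h hu
      · exact h
    have hP : P ≠ 0 := by
      intro hP0
      have : (P.roots.toFinset.filter (fun t => 0 < t)).card = 0 := by rw [hP0]; simp
      omega
    have hsym : S i₀ 1 0 = S i₀ 0 1 := by
      have h := congrFun (congrFun (hS i₀) 1) 0
      simp only [Matrix.transpose_apply] at h
      exact h.symm
    have udiag : ∀ p : Fin 6 × Fin 6, d p.1 + d p.2 = d i₀ + d i₀ → p = (i₀, i₀) := by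
      intro p hp
      have hp' : d p.1 + d p.2 = d (σ 0).1 + d (σ 0).2 := by rw [h0]; exact hp
      rcases pair_eq_of_chamber σ hcov d hd 0 p hp' with h | h
      · rw [h, h0]
      · rw [h, h0]; rfl
    have hcoeff : P.coeff (d i₀ + d i₀) = 0 := by
      rw [hP_def, coeff_det_pencil_two_diag d S i₀ udiag, hsym, ← sq, hq]
    have hsub : P.support ⊆ W.erase (d i₀ + d i₀) := by
      intro x hx
      have hxW : x ∈ W := by
        have : P.support ⊆ W := by
          rw [hP_def, hW_def, ← sumset_two_eq_pairSums d]; exact support_det_pencil_subset_sumset d S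
        exact this hx
      refine Finset.mem_erase.mpr ⟨?_, hxW⟩
      intro hxe
      rw [hxe, Polynomial.mem_support_iff] at hx
      exact hx hcoeff
    have hcard : P.support.card ≤ 20 := by
      have h1 := Finset.card_le_card hsub
      have h2 : (W.erase (d i₀ + d i₀)).card = 20 := by
        rw [Finset.card_erase_of_mem (Finset.mem_image.mpr ⟨(i₀, i₀), Finset.mem_univ _, rfl⟩), hN]
      omega
    have h := Literature.Computability.AlgebraicComplexity.card_roots_toFinset_filter_pos_lt_card_support hP
    omega
  · refine hother S hS hZ ?_
    rw [pow_succ]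
    linarith

/-! ## Two instances: the `+` cells of the mirror pair 1406 / 2183 (theory g6 ids; smallest members inside BOX20) -/

/-- **Chamber 1406 of theory g6's table** (order type of `(0,4,6,9,16,17)`, words `DIDIDD` / `IDIDII`): its `s = +`
orientation (`det S₀ > 0`, letter `0` carrying the lowest sum) is dead on the WHOLE chamber by the odd definite triangle
`{0,2,4}`; the `s = −` cell is undecided at sign level in the atlas and is NOT treated here. [folklore] -/
theorem no_twenty_on_chamber1406_pos (d : Fin 6 → ℕ)
    (hd : StrictMono ((fun p : Fin 6 × Fin 6 => d p.1 + d p.2) ∘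
      ![(0, 0), (0, 1), (0, 2), (1, 1), (0, 3), (1, 2), (2, 2), (1, 3), (2, 3), (0, 4), (0, 5),
        (3, 3), (1, 4), (1, 5), (2, 4), (2, 5), (3, 4), (3, 5), (4, 4), (4, 5), (5, 5)]))
    (S : Fin 6 → Matrix (Fin 2) (Fin 2) ℝ) (hS : ∀ l, (S l).IsSymm)
    (hZ : 20 ≤ ((∑ l, ((X : ℝ[X]) ^ d l) • (S l).map C).det.roots.toFinset.filter (fun t => 0 < t)).card)
    (hs : 0 < S 0 0 0 * S 0 1 1 - S 0 0 1 ^ 2) : False :=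
  no_twenty_on_chamber_cell _ 0 0 0 2 4 0 6 18 2 14 9 (by decide) d hd S hS hZ (by rw [pow_zero, one_mul]; exact hs)

/-- **Chamber 2183** (mirror of 1406; order type of `(0,1,8,11,13,17)`, words `DDIDID` / `IIDIDI`): its `s = +`
orientation is dead on the whole chamber by the odd definite triangle `{0,3,5}`. [folklore] -/
theorem no_twenty_on_chamber2183_pos (d : Fin 6 → ℕ)
    (hd : StrictMono ((fun p : Fin 6 × Fin 6 => d p.1 + d p.2) ∘
      ![(0, 0), (0, 1), (1, 1), (0, 2), (1, 2), (0, 3), (1, 3), (0, 4), (1, 4), (2, 2), (0, 5),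
        (1, 5), (2, 3), (2, 4), (3, 3), (3, 4), (2, 5), (4, 4), (3, 5), (4, 5), (5, 5)]))
    (S : Fin 6 → Matrix (Fin 2) (Fin 2) ℝ) (hS : ∀ l, (S l).IsSymm)
    (hZ : 20 ≤ ((∑ l, ((X : ℝ[X]) ^ d l) • (S l).map C).det.roots.toFinset.filter (fun t => 0 < t)).card)
    (hs : 0 < S 0 0 0 * S 0 1 1 - S 0 0 1 ^ 2) : False :=
  no_twenty_on_chamber_cell _ 0 0 0 3 5 0 14 20 5 18 10 (by decide) d hd S hS hZ (by rw [pow_zero, one_mul]; exact hs)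

end Summit.ValiantsHypothesis.ValiantsHypothesis.Theorems.LacunarySymmetroidMatrixDescartes.Census
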